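import Summits.RiemannHypothesis.RiemannHypothesis.Theorems.PfPersistenceF7BoxCertificate
import Summits.RiemannHypothesis.RiemannHypothesis.Theorems.GroundBartaEvenWinsBeyondArchDeflationPSD
import HarnessLib

/-!
# Motivic door / CERTPOS — exact-integer Gram certificates (`rhdoor.certpos/1`) for window matrices

pub-rhdoor (MOTIVIC-DOOR ticket), unit `certpos`. HONEST FRAMING: lottery ticket at the motivic door; RH probability
negligible; consolation prizes are real (a semi-local Weil-positivity theorem, or a located gap in the Connes–Consani
programme, plus the ff-door theorem). THIS FILE is instrumentation only — finite linear algebra, RH-free, `ζ`-free: it turns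
the integer data of a `rhdoor.certpos/1` certificate into a kernel-checked TWO-SIDED ENCLOSURE of
`ε₁ = bottomRayleigh G` of a real window matrix `G`, GIVEN entrywise enclosures of `G` (the DATA hypothesis `Encloses`,
produced off-line by two independent interval engines — Arb via the pub-weilobs core, and an independent
Euler–Maclaurin `mpmath.iv` engine — and NOT proved here).

A certificate `c : GramCert` (JSON fields `k t u Cn rn mn Ln bn` ↦ `k t u C r m L b`, all integers) is about any real
`k × k` matrix `G` with `|G i j − C i j / 2^t| ≤ r i j / 2^t` (`GramCert.Encloses`):

* LOWER (`form_ge_margin`, `margin_le_bottomRayleigh`): `margin c · vᵀv ≤ vᵀGv` for every `v`, hence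
  `margin c ≤ ε₁(G)`, where `margin c = m / 2^t − b / 2^(2u)` and the kernel-evaluable check (`GramCert.check`, or the
  shardable row checks `GramCert.rowOK i`) verifies `t ≤ 2u`, `C`, `r` symmetric on `k × k`, `|L-row i| ≤ k`, and per row
  `Σ_j ( r i j · 2^(2u−t) + |E i j| ) ≤ b` with the RESIDUAL `E i j = (C i j − m·[i=j])·2^(2u−t) − Σ_l L i l · L j l` of
  the scaled integer Cholesky factor `L / 2^u` of `(C − m)/2^t`. Soundness is the perturbation lemma
  `dt_quadForm_nonneg_of_near` + the `LDLᵀ` margin `dt_quadForm_ge_of_ldl` (EvenWinsBeyondArch; [cite: Rump2006PosDef, §2]):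
  `G − margin·1 = (b/4^u)·1 + LLᵀ/4^u + (G − C/2^t) + E/4^u` and the last two are entrywise within a matrix whose row
  and column sums are `≤ b/4^u`.
* UPPER (`bottomRayleigh_le_of_upperOK`): an integer witness vector `w ≠ 0` with
  `(wᵀ C w + |w|ᵀ r |w|) · den ≤ num · 2^t · wᵀw` gives `ε₁(G) ≤ num / den` (`bottomRayleigh_le_rayleigh`).

Per-cell files (`MotivicDoorCertPos…`) instantiate `G := zetaDatum ⟨a, N, _⟩` (= `evenBlock zetaWeights`, PfPersistence)
or `oddBlock zetaWeights ⟨a, N, _⟩`, or a semi-local `datumOf w` for a place set `S`, prove `check`/`rowOK` by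
`decide +kernel` (sharded by rows), and conclude `Encloses G → margin ≤ ε₁(G) ∧ ε₁(G) ≤ num/den`. Every number in them is
reproduced by two engines and re-verified by a stdlib checker before being typed; the enclosure itself stays a hypothesis
(DATA), exactly as in `Literature.NumberTheory.Connes2026.X13Certificate` and `PfPersistenceF7BoxCertificate`.
-/

open Finset Matrix
open scoped BigOperators

namespace Summit.RiemannHypothesis.RiemannHypothesis.Theorems.MotivicDoor.CertPos

open Summit.RiemannHypothesis.RiemannHypothesis.Theorems.PfPersistence
open Summit.RiemannHypothesis.RiemannHypothesis.Theorems.EvenWinsBeyondArch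

/-- The integer data of a `rhdoor.certpos/1` certificate: dimension `k`, scales `2^t` (entries, shift) and `2^u`
(Cholesky factor), midpoints `C`, radii `r`, shift `m`, lower-triangular factor rows `L`, budget `b`. [folklore] -/
structure GramCert where
  k : ℕ
  t : ℕ
  u : ℕ
  C : List (List ℤ)
  r : List (List ℕ)
  m : ℤ
  L : List (List ℤ)
  b : ℕ

namespace GramCert

variable (c : GramCert)

/-- midpoint numerator `C i j` (entries outside the lists read as `0`). [folklore] -/
def Cij (i j : ℕ) : ℤ := (c.C.getD i []).getD j 0
/-- radius numerator `r i j`. [folklore] -/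
def rij (i j : ℕ) : ℕ := (c.r.getD i []).getD j 0
/-- row `i` of the integer Cholesky factor. [folklore] -/
def Lrow (i : ℕ) : List ℤ := c.L.getD i []
/-- entry `L i l`. [folklore] -/
def Lij (i l : ℕ) : ℤ := (c.Lrow i).getD l 0
/-- `Σ_l L i l · L j l`, computed in linear time as a `zipWith` over the two rows. [folklore] -/
def dotL (i j : ℕ) : ℤ := (List.zipWith (· * ·) (c.Lrow i) (c.Lrow j)).sum
/-- the rescaling factor `2^(2u − t)` between the entry scale and the squared factor scale. [folklore] -/
def scale : ℕ := 2 ^ (2 * c.u - c.t)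
/-- the RESIDUAL numerator `E i j = (C i j − m·[i = j])·2^(2u−t) − Σ_l L i l · L j l` (scale `2^(2u)`). [folklore] -/
def Eij (i j : ℕ) : ℤ := (c.Cij i j - if i = j then c.m else 0) * c.scale - c.dotL i j
/-- row budget `Σ_{j<k} ( r i j · 2^(2u−t) + |E i j| )` (scale `2^(2u)`). [folklore] -/
def rowBudget (i : ℕ) : ℕ := ∑ j ∈ Finset.range c.k, (c.rij i j * c.scale + (c.Eij i j).natAbs)
/-- ROW CHECK `i` (kernel-evaluable, shardable): budget `≤ b`, `L`-row length `≤ k`, symmetry of `C` and `r` against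
row `i`. [folklore] -/
def rowOK (i : ℕ) : Bool :=
  decide (c.rowBudget i ≤ c.b) && decide ((c.Lrow i).length ≤ c.k) &&
    (List.range c.k).all fun j => decide (c.Cij i j = c.Cij j i) && decide (c.rij i j = c.rij j i)
/-- THE CHECK: `t ≤ 2u` and every row check. [folklore] -/
def check : Bool := decide (c.t ≤ 2 * c.u) && (List.range c.k).all fun i => c.rowOK i
/-- the certified margin `m / 2^t − b / 2^(2u)` (an exact rational). [folklore] -/
def margin : ℚ := (c.m : ℚ) / 2 ^ c.t - (c.b : ℚ) / 2 ^ (2 * c.u)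

/-- What soundness consumes (assemble it from `check`, or from sharded `rowOK` lemmas). [folklore] -/
structure Valid : Prop where
  htu : c.t ≤ 2 * c.u
  hrow : ∀ i < c.k, c.rowOK i = true

/-- PROVED: the one-shot check implies validity. [folklore] -/
theorem valid_of_check (h : c.check = true) : c.Valid := by
  simp only [check, Bool.and_eq_true, decide_eq_true_eq, List.all_eq_true, List.mem_range] at h
  exact ⟨h.1, h.2⟩

/-- PROVED: validity from `t ≤ 2u` and the row checks (the sharded form). [folklore] -/
theorem valid_of_rows (htu : c.t ≤ 2 * c.u) (hrow : ∀ i < c.k, c.rowOK i = true) : c.Valid := ⟨htu, hrow⟩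

/-- a SHARD of row checks: rows `a ≤ i < a + n`. [folklore] -/
def rowsOK (a n : ℕ) : Bool := (List.range' a n).all fun i => c.rowOK i

/-- PROVED: a row inside a passing shard passes. [folklore] -/
theorem rowOK_of_rowsOK {a n : ℕ} (h : c.rowsOK a n = true) {i : ℕ} (hai : a ≤ i) (hin : i < a + n) :
    c.rowOK i = true := by
  simp only [rowsOK, List.all_eq_true, List.mem_range'_1] at h
  exact h i ⟨hai, hin⟩

/-- PROVED: validity from `s` consecutive shards of width `n` covering `[0, k)` (the sharded kernel idiom: one
`decide +kernel` theorem per shard). [folklore] -/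
theorem valid_of_shards (htu : c.t ≤ 2 * c.u) (n s : ℕ) (hn : 0 < n) (hcover : c.k ≤ n * s)
    (h : ∀ q < s, c.rowsOK (n * q) n = true) : c.Valid :=
  ⟨htu, fun i hi =>
    c.rowOK_of_rowsOK (h (i / n) ((Nat.div_lt_iff_lt_mul hn).2 (by rw [Nat.mul_comm]; omega)))
      (Nat.mul_div_le i n) (Nat.lt_mul_div_succ i hn)⟩

/-- THE DATA HYPOTHESIS: `G` is entrywise enclosed by the certificate's balls `C i j / 2^t ± r i j / 2^t`. [folklore] -/
def Encloses {n : ℕ} (G : Matrix (Fin n) (Fin n) ℝ) : Prop :=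
  ∀ i j : Fin n, |G i j - (c.Cij i j : ℝ) / 2 ^ c.t| ≤ (c.rij i j : ℝ) / 2 ^ c.t

/-- UPPER-BOUND WITNESS CHECK: `w` has length `k`, is nonzero, `0 < den`, and
`(wᵀ C w + |w|ᵀ r |w|) · den ≤ num · 2^t · wᵀw` in integers. [folklore] -/
def upperOK (w : List ℤ) (num : ℤ) (den : ℕ) : Bool :=
  decide (w.length = c.k) && decide (0 < den) && ((List.range c.k).any fun i => w.getD i 0 != 0) &&
    decide ((∑ i ∈ Finset.range c.k, ∑ j ∈ Finset.range c.k,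
        (w.getD i 0 * w.getD j 0 * c.Cij i j + |w.getD i 0| * |w.getD j 0| * (c.rij i j : ℤ))) * (den : ℤ)
      ≤ num * 2 ^ c.t * ∑ i ∈ Finset.range c.k, w.getD i 0 ^ 2)

end GramCert

/-- PROVED: a `zipWith` product-sum of two lists is the `Finset.range` sum of the padded entries. [folklore] -/
theorem sum_zipWith_mul_eq_sum_range (a b : List ℤ) (W : ℕ) (ha : a.length ≤ W) (hb : b.length ≤ W) :
    (List.zipWith (· * ·) a b).sum = ∑ l ∈ Finset.range W, a.getD l 0 * b.getD l 0 := by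
  induction a generalizing b W with
  | nil => simp
  | cons x a ih =>
    cases b with
    | nil => simp
    | cons y b =>
      cases W with
      | zero => simp at ha
      | succ W =>
        simp only [List.length_cons, Nat.succ_le_succ_iff] at ha hb
        rw [List.zipWith_cons_cons, List.sum_cons, Finset.sum_range_succ', ih b W ha hb]
        simp only [List.getD_cons_succ, List.getD_cons_zero]
        ring

open GramCert in
/-- **PROVED — SOUNDNESS (lower bound, homogeneous form).** A valid certificate and the enclosure hypothesis give
`margin · vᵀv ≤ vᵀGv` for every `v`. [cite: Rump2006PosDef, §2 (perturbation argument)] -/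
theorem form_ge_margin (c : GramCert) (hv : c.Valid) {n : ℕ} (hk : c.k = n) (G : Matrix (Fin n) (Fin n) ℝ)
    (hG : c.Encloses G) (v : Fin n → ℝ) : (c.margin : ℝ) * (v ⬝ᵥ v) ≤ v ⬝ᵥ (G *ᵥ v) := by
  classical
  obtain ⟨htu, hrow⟩ := hv
  -- unpack the row checks
  have hR : ∀ i : Fin n, c.rowBudget i ≤ c.b ∧ (c.Lrow i).length ≤ n ∧
      ∀ j : Fin n, c.Cij i j = c.Cij j i ∧ c.rij i j = c.rij j i := by
    intro i
    have h := hrow i (lt_of_lt_of_eq i.isLt hk.symm)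
    simp only [GramCert.rowOK, Bool.and_eq_true, decide_eq_true_eq, List.all_eq_true, List.mem_range] at h
    exact ⟨h.1.1, h.1.2.trans_eq hk, fun j => h.2 j (lt_of_lt_of_eq j.isLt hk.symm)⟩
  have hT0 : (0 : ℝ) < 2 ^ c.t := by positivity
  have hU0 : (0 : ℝ) < 2 ^ c.u := by positivity
  have hscale : ((c.scale : ℕ) : ℝ) = (2 ^ c.u) ^ 2 / 2 ^ c.t := by
    rw [eq_div_iff hT0.ne', GramCert.scale, Nat.cast_pow, Nat.cast_ofNat, ← pow_add, Nat.sub_add_cancel htu, pow_mul']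
  have hmargin : ((c.margin : ℚ) : ℝ) = (c.m : ℝ) / 2 ^ c.t - (c.b : ℝ) / (2 ^ c.u) ^ 2 := by
    rw [← pow_mul']
    push_cast [GramCert.margin]
    try ring
  -- the dot products as `Fin n` sums
  have hdot : ∀ i j : Fin n, (c.dotL i j : ℝ) = ∑ l : Fin n, (c.Lij i l : ℝ) * (c.Lij j l : ℝ) := by
    intro i j
    simp only [GramCert.dotL, sum_zipWith_mul_eq_sum_range _ _ n (hR i).2.1 (hR j).2.1, Finset.sum_range,
      Int.cast_sum, Int.cast_mul, GramCert.Lij]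
  -- Kronecker delta bookkeeping
  have hdelta : ∀ i j : Fin n, ((if (i : ℕ) = (j : ℕ) then c.m else 0 : ℤ) : ℝ) =
      (if i = j then (1 : ℝ) else 0) * (c.m : ℝ) := by
    intro i j
    by_cases hij : i = j
    · subst hij; simp
    · simp [hij, Fin.val_inj]
  have hE : ∀ i j : Fin n, (c.Eij i j : ℝ) =
      ((c.Cij i j : ℝ) - (if i = j then (1 : ℝ) else 0) * (c.m : ℝ)) * ((2 ^ c.u) ^ 2 / 2 ^ c.t)
        - ∑ l : Fin n, (c.Lij i l : ℝ) * (c.Lij j l : ℝ) := by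
    intro i j
    rw [← hscale, ← hdot i j, ← hdelta i j, GramCert.Eij]
    push_cast
    ring
  -- the comparison data for the perturbation lemma
  set δ' : ℝ := (c.b : ℝ) / (2 ^ c.u) ^ 2 with hδ'
  set Lr : Fin n → Fin n → ℝ := fun l i => (c.Lij i l : ℝ) / 2 ^ c.u with hLr
  set P : Fin n → Fin n → ℝ := fun i j => δ' * (if i = j then 1 else 0) + ∑ l, 1 * Lr l i * Lr l j with hP
  set F : Fin n → Fin n → ℝ := fun i j => (c.rij i j : ℝ) / 2 ^ c.t + |(c.Eij i j : ℝ)| / (2 ^ c.u) ^ 2 with hF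
  set M : Fin n → Fin n → ℝ := fun i j => G i j - (c.margin : ℝ) * (if i = j then 1 else 0) with hM
  have hPform : ∀ α : Fin n → ℝ, δ' * ∑ i, α i ^ 2 ≤ ∑ i, ∑ j, α i * α j * P i j :=
    dt_quadForm_ge_of_ldl P (fun _ => 1) Lr δ' (fun _ => zero_le_one) (fun i j => rfl)
  -- M − P = (G − C/2^t) + E/4^u
  have hsumL : ∀ i j : Fin n, ∑ l, 1 * Lr l i * Lr l j = (∑ l : Fin n, (c.Lij i l : ℝ) * (c.Lij j l : ℝ)) / (2 ^ c.u) ^ 2 := by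
    intro i j
    rw [Finset.sum_div]
    refine Finset.sum_congr rfl fun l _ => ?_
    simp only [hLr, one_mul]
    field_simp
  have hMP : ∀ i j : Fin n, M i j - P i j = (G i j - (c.Cij i j : ℝ) / 2 ^ c.t) + (c.Eij i j : ℝ) / (2 ^ c.u) ^ 2 := by
    intro i j
    simp only [hM, hP, hsumL, hE, hmargin, hδ']
    field_simp
    ring
  have hEF : ∀ i j, |M i j - P i j| ≤ F i j := by
    intro i j
    rw [hMP]
    simp only [hF]
    refine (abs_add_le _ _).trans (add_le_add (hG i j) ?_)
    rw [abs_div, abs_of_pos (by positivity : (0 : ℝ) < (2 ^ c.u) ^ 2)]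
  -- row sums of F
  have hrb : ∀ i : Fin n, ((c.rowBudget i : ℕ) : ℝ) = ∑ j : Fin n, ((c.rij i j : ℝ) * c.scale + |(c.Eij i j : ℝ)|) := by
    intro i
    rw [GramCert.rowBudget, hk, Finset.sum_range]
    push_cast
    simp only [Nat.cast_natAbs, Int.cast_abs]
  have hrowF : ∀ i, ∑ j, F i j ≤ δ' := by
    intro i
    have h1 : ∑ j, F i j = ((c.rowBudget i : ℕ) : ℝ) / (2 ^ c.u) ^ 2 := by
      rw [hrb, Finset.sum_div]
      refine Finset.sum_congr rfl fun j _ => ?_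
      simp only [hF, hscale]
      field_simp
    rw [h1, hδ']
    exact div_le_div_of_nonneg_right (by exact_mod_cast (hR i).1) (by positivity)
  -- F is symmetric (C, r symmetric; the residual is symmetric)
  have hEsymm : ∀ i j : Fin n, (c.Eij i j : ℝ) = c.Eij j i := by
    intro i j
    rw [hE, hE]
    have hC : (c.Cij i j : ℝ) = c.Cij j i := by exact_mod_cast ((hR i).2.2 j).1
    have hd : (if i = j then (1 : ℝ) else 0) = if j = i then 1 else 0 := by
      by_cases hij : i = j
      · subst hij; rfl
      · rw [if_neg hij, if_neg (Ne.symm hij)]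
    rw [hC, hd]
    congr 1
    exact Finset.sum_congr rfl fun l _ => mul_comm _ _
  have hFsymm : ∀ i j, F i j = F j i := by
    intro i j
    have hr : (c.rij i j : ℝ) = c.rij j i := by exact_mod_cast ((hR i).2.2 j).2
    simp only [hF, hr, hEsymm i j]
  have hcolF : ∀ j, ∑ i, F i j ≤ δ' := by
    intro j
    rw [Finset.sum_congr rfl fun i _ => hFsymm i j]
    exact hrowF j
  -- the perturbation lemma
  have key := dt_quadForm_nonneg_of_near M P F δ' hEF hrowF hcolF hPform v
  -- unfold the quadratic form of M
  have hquadG : v ⬝ᵥ (G *ᵥ v) = ∑ i, ∑ j, v i * v j * G i j := by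
    simp only [dotProduct, mulVec, Finset.mul_sum]
    exact Finset.sum_congr rfl fun i _ => Finset.sum_congr rfl fun j _ => by ring
  have hquadI : ∑ i, ∑ j, v i * v j * ((c.margin : ℝ) * (if i = j then 1 else 0)) = (c.margin : ℝ) * (v ⬝ᵥ v) := by
    simp only [dotProduct, Finset.mul_sum]
    refine Finset.sum_congr rfl fun i _ => ?_
    rw [Finset.sum_eq_single i (fun j _ hji => by rw [if_neg (Ne.symm hji)]; ring) (fun h => (h (mem_univ i)).elim),
      if_pos rfl]
    ring
  have hquadM : ∑ i, ∑ j, v i * v j * M i j = v ⬝ᵥ (G *ᵥ v) - (c.margin : ℝ) * (v ⬝ᵥ v) := by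
    rw [hquadG, ← hquadI, ← Finset.sum_sub_distrib]
    refine Finset.sum_congr rfl fun i _ => ?_
    rw [← Finset.sum_sub_distrib]
    exact Finset.sum_congr rfl fun j _ => by simp only [hM]; ring
  linarith [key, hquadM]

open GramCert in
/-- **PROVED — THE CERTIFICATE THEOREM (lower):** `margin c ≤ ε₁(G)` (positive dimension). [folklore] -/
theorem margin_le_bottomRayleigh (c : GramCert) (hv : c.Valid) {N : ℕ} (hk : c.k = N + 1)
    (G : Matrix (Fin (N + 1)) (Fin (N + 1)) ℝ) (hG : c.Encloses G) : (c.margin : ℝ) ≤ bottomRayleigh G :=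
  le_bottomRayleigh_of_form_ge G fun v => form_ge_margin c hv hk G hG v

open GramCert in
/-- **PROVED — THE CERTIFICATE THEOREM (upper):** an integer witness passing `upperOK` gives `ε₁(G) ≤ num / den`.
[folklore] -/
theorem bottomRayleigh_le_of_upperOK (c : GramCert) {N : ℕ} (hk : c.k = N + 1)
    (G : Matrix (Fin (N + 1)) (Fin (N + 1)) ℝ) (hG : c.Encloses G) (w : List ℤ) (num : ℤ) (den : ℕ)
    (h : c.upperOK w num den = true) : bottomRayleigh G ≤ (num : ℝ) / den := by
  classical
  simp only [GramCert.upperOK, Bool.and_eq_true, decide_eq_true_eq, List.any_eq_true, List.mem_range, bne_iff_ne,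
    ne_eq] at h
  obtain ⟨⟨⟨hlen, hden⟩, ⟨i0, hi0, hwi0⟩⟩, hineq⟩ := h
  rw [hk] at hi0 hineq
  set x : Fin (N + 1) → ℝ := fun i => (w.getD i 0 : ℝ) with hx
  have hx0 : x ≠ 0 := by
    intro h0
    have := congr_fun h0 ⟨i0, hi0⟩
    simp only [hx, Pi.zero_apply, Int.cast_eq_zero] at this
    exact hwi0 this
  have hT0 : (0 : ℝ) < 2 ^ c.t := by positivity
  have hden0 : (0 : ℝ) < den := by exact_mod_cast hden
  -- the real form of the integer inequality
  have hineqR : (∑ i : Fin (N + 1), ∑ j : Fin (N + 1),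
      (x i * x j * (c.Cij i j : ℝ) + |x i| * |x j| * (c.rij i j : ℝ))) * (den : ℝ)
      ≤ (num : ℝ) * 2 ^ c.t * ∑ i : Fin (N + 1), x i ^ 2 := by
    have h' : (((∑ i ∈ Finset.range (N + 1), ∑ j ∈ Finset.range (N + 1),
        (w.getD i 0 * w.getD j 0 * c.Cij i j + |w.getD i 0| * |w.getD j 0| * (c.rij i j : ℤ))) * (den : ℤ) : ℤ) : ℝ)
        ≤ ((num * 2 ^ c.t * ∑ i ∈ Finset.range (N + 1), w.getD i 0 ^ 2 : ℤ) : ℝ) := by exact_mod_cast hineq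
    push_cast at h'
    simpa only [Finset.sum_range, hx] using h'
  -- entrywise: x_i x_j G_ij ≤ x_i x_j C_ij/2^t + |x_i||x_j| r_ij/2^t
  have hent : ∀ i j : Fin (N + 1), x i * x j * G i j ≤
      (x i * x j * (c.Cij i j : ℝ) + |x i| * |x j| * (c.rij i j : ℝ)) / 2 ^ c.t := by
    intro i j
    have h1 : x i * x j * G i j = x i * x j * ((c.Cij i j : ℝ) / 2 ^ c.t) + x i * x j * (G i j - (c.Cij i j : ℝ) / 2 ^ c.t) := by
      ring
    have h2 : x i * x j * (G i j - (c.Cij i j : ℝ) / 2 ^ c.t) ≤ |x i| * |x j| * ((c.rij i j : ℝ) / 2 ^ c.t) := by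
      calc x i * x j * (G i j - (c.Cij i j : ℝ) / 2 ^ c.t)
          ≤ |x i * x j * (G i j - (c.Cij i j : ℝ) / 2 ^ c.t)| := le_abs_self _
        _ = |x i| * |x j| * |G i j - (c.Cij i j : ℝ) / 2 ^ c.t| := by rw [abs_mul, abs_mul]
        _ ≤ |x i| * |x j| * ((c.rij i j : ℝ) / 2 ^ c.t) :=
          mul_le_mul_of_nonneg_left (hG i j) (mul_nonneg (abs_nonneg _) (abs_nonneg _))
    rw [h1, add_div]
    have h3 : x i * x j * ((c.Cij i j : ℝ) / 2 ^ c.t) = x i * x j * (c.Cij i j : ℝ) / 2 ^ c.t := by ring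
    have h4 : |x i| * |x j| * ((c.rij i j : ℝ) / 2 ^ c.t) = |x i| * |x j| * (c.rij i j : ℝ) / 2 ^ c.t := by ring
    linarith
  have hform : x ⬝ᵥ (G *ᵥ x) ≤ ((num : ℝ) / den) * (x ⬝ᵥ x) := by
    have hq : x ⬝ᵥ (G *ᵥ x) = ∑ i, ∑ j, x i * x j * G i j := by
      simp only [dotProduct, mulVec, Finset.mul_sum]
      exact Finset.sum_congr rfl fun i _ => Finset.sum_congr rfl fun j _ => by ring
    have hxx : x ⬝ᵥ x = ∑ i, x i ^ 2 := by
      simp only [dotProduct]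
      exact Finset.sum_congr rfl fun i _ => by ring
    have hle : ∑ i, ∑ j, x i * x j * G i j ≤
        (∑ i, ∑ j, (x i * x j * (c.Cij i j : ℝ) + |x i| * |x j| * (c.rij i j : ℝ))) / 2 ^ c.t := by
      rw [Finset.sum_div]
      refine Finset.sum_le_sum fun i _ => ?_
      rw [Finset.sum_div]
      exact Finset.sum_le_sum fun j _ => hent i j
    rw [hq, hxx]
    refine hle.trans ?_
    rw [div_le_iff₀ hT0]
    have h5 : ∑ i, ∑ j, (x i * x j * (c.Cij i j : ℝ) + |x i| * |x j| * (c.rij i j : ℝ))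
        ≤ (num : ℝ) * 2 ^ c.t * (∑ i, x i ^ 2) / den := by
      rw [le_div_iff₀ hden0]
      exact hineqR
    calc ∑ i, ∑ j, (x i * x j * (c.Cij i j : ℝ) + |x i| * |x j| * (c.rij i j : ℝ))
        ≤ (num : ℝ) * 2 ^ c.t * (∑ i, x i ^ 2) / den := h5
      _ = (num : ℝ) / den * (∑ i, x i ^ 2) * 2 ^ c.t := by ring
  have hxx : 0 < x ⬝ᵥ x :=
    lt_of_le_of_ne (dotProduct_self_nonneg_real x) fun h0 => hx0 (dotProduct_self_eq_zero.1 h0.symm)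
  exact (bottomRayleigh_le_rayleigh G hx0).trans ((div_le_iff₀ hxx).2 hform)

end Summit.RiemannHypothesis.RiemannHypothesis.Theorems.MotivicDoor.CertPos
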